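import Summits.BirchSwinnertonDyer.Rank1Residual.Additive.GordBranchPAdicGrossZagierOdd
import Summits.BirchSwinnertonDyer.Rank1Residual.Additive.GordThreeCycRankOne
import HarnessLib

/-!
# The (G)-cell at analytic rank ONE, ODD branch AT `p = 3`: the forward direction "p07's W-level
# odd-branch LOWER input ∧ the typed `3`-adic Gross–Zagier `BranchPAdicGrossZagierOddAt W 3 Dh` ⟹
# `Typed.MissingLowerBoundAt W 3`" with Delbourgo 2002 AT `3` in place of A175 (cell `b2b-bsdres`,
# team n1011, seat p12 (gen 2); the `p = 3` gap named by route planner 3 GEN 5, 2026-08-21T07:14Z)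

HONEST FRAMING (cell `b2b-bsdres`, run/shared/lean/b2b/bsd-rank1-residual/, verbatim in every
file): the goal of the cell is to DELETE the COMBINATION-SHAPED residual classes of the
Birch–Swinnerton-Dyer formula for ALL analytic-rank `≤ 1` elliptic curves over `ℚ` — "full BSD
formula for every rank `≤ 1` curve in class `C`" assembled STRICTLY from published theorems — so
that the rank-`≤ 1` remainder becomes exactly the CONSTRUCTION-SHAPED classes, which are TYPED
(missing-input `Prop`s), NOT attempted. This is not "finishing BSD". Team n1011 (RESIDUAL-MAP §I
O7-ord at `p = 3`), seat `b2b-bsdres-n1011-p12` (gen 2): research route on the CONSTRUCTION-SHAPED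
class O7 (and X3♯/X4♯(G-ord)); labels and marks UNCHANGED; nothing booked; NO Literature fact
minted; no definition. THEOREMS ONLY; named facts are explicit HYPOTHESES (`hDel3` =
`Delbourgo2002.mainTheorem_three`, the `p = 3` form of Delbourgo, JNT 95 (2002) Thms. (A)+(B), typed
by n1011-p16; `hmod`, `hmodD`, `hGZK`); the typed OPEN inputs are seat p07's
`ChiBranchLowerDivisibilityOddAt W 3` (the Skinner–Urban direction on the `ω¹`-branch of `E ⊗ χ_{−3}`,
OUR conjecture) and seat p01's `BranchPAdicGrossZagierOddAt W 3 Dh` (the `3`-adic Gross–Zagier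
identity on that branch, OPEN in rank one), with the Schneider rider as in p01's gen-1 statement.

## What and why

Seat p01 (`GordBranchPAdicGrossZagierOdd.lean`, gen 1) proved the FACTORISATION
`ChiBranchLowerDivisibilityOddAt W p ∧ BranchPAdicGrossZagierOddAt W p Dh ⟹ CycLowerBoundAt W p Dh`
at EVERY `p ≡ 3 (mod 4)` (`cycLowerBoundAt_of_chiBranchLowerOdd_of_branchPAdicGrossZagierOdd`, `p = 3`
included) and the class form `ClassX4Gord.missingLowerBoundAt_rankOne_of_chiBranchLowerOdd_of_branchPAdicGrossZagierOdd`
only at `p ≥ 5` (hence `p ≥ 7`), because the leading-term input there is A175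
(`Delbourgo2002.mainTheorem`, `5 ≤ p`); p01 GEN 2's converse (`GordBranchPAdicGrossZagierOddConverse.lean`)
already includes `p = 3`. THIS FILE supplies the forward class forms AT `p = 3` over n1011-p16's
`p = 3` rank-one core (`ClassX4Gord/ClassX3Gord.missingLowerBoundAt_three_rankLeOne_of_cycLowerBound`,
Delbourgo 2002 at `3` via `TypeGOrd.delbourgo2002_three`): on X4♯(G-ord)@3 (defect `2` AUTOMATIC at
`3`, `semistabilityIndex_eq_two_of_typeG_three`) and on X3♯(G-ord)@3, non-CM, non-anomalous,
`r_an = 1`: the two typed inputs of the odd-branch route ⟹ `Typed.MissingLowerBoundAt W 3`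
(`ClassX4Gord.missingLowerBoundAt_three_rankOne_of_chiBranchLowerOdd_of_branchPAdicGrossZagierOdd`,
`ClassX3Gord.…`). With p01 GEN 2's converse and this seat's T-O7K3 files the 'typed `3`-adic GZ ⟺
`BSD₃` modulo the branch IMC' loop (route planner 3, R3-S3) is closed at `p = 3` off the anomalous
rows. Nothing booked; O7 stays CONSTRUCTION-SHAPED.

References: [Delbourgo2002] Thm. (A), (B) (p. 40); [MazurTateTeitelbaum1986Invent] §I.14;
[Delbourgo1998] §2.5 (p. 151) (shape); [Miller2011LMS] Def. 1.1.
-/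

noncomputable section

open scoped Classical MatrixGroups ModularForm NumberField

open CongruenceSubgroup WeierstrassCurve NumberField Literature.NumberTheory.EllipticCurves
  Literature.NumberTheory.EllipticCurves.ModularForms
  Literature.NumberTheory.EllipticCurves.Rank1Residual
  Literature.NumberTheory.EllipticCurves.Rank1Residual.Typed
  Literature.NumberTheory.EllipticCurves.Delbourgo2002
  IsDedekindDomain

namespace Summit.BirchSwinnertonDyer.Rank1Residual.Additive

variable {W : WeierstrassCurve ℚ} [W.IsElliptic] [W.IsGloballyMinimal] [hp : Fact (Nat.Prime 3)]

/-- **X4♯(G-ord) at `3` (Kodaira `I₀*` automatic), non-CM, non-anomalous, `r_an = 1`: the LOWER half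
from the two typed inputs of the odd-branch route** — p07's `ChiBranchLowerDivisibilityOddAt W 3` and,
for every Delbourgo (B)-datum, the Schneider rider + p01's `BranchPAdicGrossZagierOddAt W 3 Dh` — all
other binders published: Delbourgo 2002 AT `3` (`hDel3`, n1011-p16), modularity (`hmod`, `hmodD`), GZK;
the twist datum `(V, C, f, ϖ⁻)` is DISCHARGED (`ClassX4Gord.exists_goodOrd_pStar_twist_model`, `hmodD`,
`exists_rat_mul_imaginaryPeriodRat_eq_minusPeriod`). p01's factorisation at `3` into n1011-p16's
`ClassX4Gord.missingLowerBoundAt_three_rankLeOne_of_cycLowerBound`.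
[cite: Delbourgo2002, Theorem (A), (B) (p. 40)] [cite: Miller2011LMS, Def. 1.1]
[cite: MazurTateTeitelbaum1986Invent, §I.14] -/
theorem ClassX4Gord.missingLowerBoundAt_three_rankOne_of_chiBranchLowerOdd_of_branchPAdicGrossZagierOdd
    (hDel3 : Delbourgo2002.mainTheorem_three) (hmod : hasEntireLFunction_rat)
    (hmodD : nonempty_modularParametrizationData) (hGZK : rank_eq_analyticRank_of_analyticRank_le_one)
    (hX : ClassX4Gord W 3) (hcm : ¬ W.HasCM) (hna : ReductionNonAnomalous W 3) (hr : W.analyticRank = 1)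
    (hdiv : ChiBranchLowerDivisibilityOddAt W 3)
    (hGZ : ∀ Dh : PAdicHeightData W 3, LeadingTermClauses W 3 Dh →
      SchneiderConjecture Dh ∧ BranchPAdicGrossZagierOddAt W 3 Dh) :
    MissingLowerBoundAt W 3 := by
  have he : semistabilityIndex W 3 = 2 :=
    semistabilityIndex_eq_two_of_typeG_three W hX.typeGOrd.typeG hX.addv.2
  obtain ⟨V, iV, iVm, C, hV, hC⟩ := hX.exists_goodOrd_pStar_twist_model W 3 he
  haveI : NeZero (V.conductorNorm ℤ) := ⟨(V.conductorNorm_pos_holds).ne'⟩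
  obtain ⟨Dm⟩ := hmodD V
  obtain ⟨ϖ, -, hϖ⟩ := exists_rat_mul_imaginaryPeriodRat_eq_minusPeriod Dm
  have hVW : ∃ C : VariableChange ℚ, C • V.quadraticTwist (-((3 : ℕ) : ℚ)) = W :=
    ⟨C, by have h := hC; norm_num at h ⊢; exact h⟩
  refine ClassX4Gord.missingLowerBoundAt_three_rankLeOne_of_cycLowerBound hDel3 hGZK hX hcm hr.le hna
    fun Dh hB ↦ ?_
  obtain ⟨hS, hGZDh⟩ := hGZ Dh hB
  exact ⟨hS, cycLowerBoundAt_of_chiBranchLowerOdd_of_branchPAdicGrossZagierOdd W 3 hmod hGZK hX.addv.2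
    hr (by norm_num) V hVW hV Dm.isNewformOf ϖ hϖ hdiv hGZDh⟩

/-- **X3♯(G-ord) at `3`, non-CM, non-anomalous, `r_an = 1` (reducible `E[3]`): the LOWER half from
the same two typed inputs** (the defect hypothesis `e = 2` is kept — on X3 the good-ordinary twist
model is supplied by `TypeGOrd.exists_goodOrd_pStar_twist_model` on the defect-`2` rows).
[cite: Delbourgo2002, Theorem (A), (B) (p. 40)] [cite: Miller2011LMS, Def. 1.1] -/
theorem ClassX3Gord.missingLowerBoundAt_three_rankOne_of_chiBranchLowerOdd_of_branchPAdicGrossZagierOdd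
    (hDel3 : Delbourgo2002.mainTheorem_three) (hmod : hasEntireLFunction_rat)
    (hmodD : nonempty_modularParametrizationData) (hGZK : rank_eq_analyticRank_of_analyticRank_le_one)
    (hX : ClassX3Gord W 3) (hcm : ¬ W.HasCM) (hna : ReductionNonAnomalous W 3) (hr : W.analyticRank = 1)
    (hdiv : ChiBranchLowerDivisibilityOddAt W 3)
    (hGZ : ∀ Dh : PAdicHeightData W 3, LeadingTermClauses W 3 Dh →
      SchneiderConjecture Dh ∧ BranchPAdicGrossZagierOddAt W 3 Dh) :
    MissingLowerBoundAt W 3 := by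
  have he : semistabilityIndex W 3 = 2 :=
    semistabilityIndex_eq_two_of_typeG_three W hX.typeGOrd.typeG hX.addv
  obtain ⟨V, iV, iVm, C, hV, hC⟩ :=
    TypeGOrd.exists_goodOrd_pStar_twist_model W 3 (by decide) hX.typeGOrd hX.addv he
  haveI : NeZero (V.conductorNorm ℤ) := ⟨(V.conductorNorm_pos_holds).ne'⟩
  obtain ⟨Dm⟩ := hmodD V
  obtain ⟨ϖ, -, hϖ⟩ := exists_rat_mul_imaginaryPeriodRat_eq_minusPeriod Dm
  have hVW : ∃ C : VariableChange ℚ, C • V.quadraticTwist (-((3 : ℕ) : ℚ)) = W :=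
    ⟨C, by have h := hC; norm_num at h ⊢; exact h⟩
  refine ClassX3Gord.missingLowerBoundAt_three_rankLeOne_of_cycLowerBound hDel3 hGZK hX hcm hr.le hna
    fun Dh hB ↦ ?_
  obtain ⟨hS, hGZDh⟩ := hGZ Dh hB
  exact ⟨hS, cycLowerBoundAt_of_chiBranchLowerOdd_of_branchPAdicGrossZagierOdd W 3 hmod hGZK hX.addv
    hr (by norm_num) V hVW hV Dm.isNewformOf ϖ hϖ hdiv hGZDh⟩

end Summit.BirchSwinnertonDyer.Rank1Residual.Additive

end
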